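import Literature.Topology.FourManifolds.FishtailIota
import HarnessLib

/-!
# Concrete parameters of the fishtail tube and end map

Infrastructure for the explicit fishtail neighbourhood (R. Gompf, *More Cappell–Shaneson spheres
are standard*, Algebr. Geom. Topol. 10 (2010), proof of Thm 2.1 and Lemma 2.2; the named fact
`Literature.Topology.FourManifolds.gompf2010_framedTwist`). The tube about Gompf's disc
(`TubeDData`, `FishtailTubeD.lean`) and the end map (`IotaData`, `FishtailIotaTwo.lean`) carry
some sixty parameters; here they are fixed as explicit functions of the surgery radius
`ε ∈ (0, 1/2]` (and of a few existentially given radii: the bound `C₀` of the derivative of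
`Real.smoothTransition`, the switch radius of the cap chart, and the Jacobian / injectivity radii
of the two planar shells):

* the scales `FP.lam`, the profiles `FP.kap` (cone → constant), `FP.muN`, `FP.muS`, `FP.muL`,
  the vertical profile `FP.vert`, the latitude data, the glue radii `FP.s₁ … FP.s₇` placed at
  angles with closed-form tangents of the master angles `angleUp r₀`, `angleDown r₁`;
* `Literature.Topology.FourManifolds.fishT ε hε hε2 : TubeDData` and
  `Literature.Topology.FourManifolds.fishJ ε hε hε2 : IotaData`;
* elementary facts: positivity and ordering of the radii, the value of `t_j`.

Everything is proved; no named facts.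

## References

* R. E. Gompf, *More Cappell–Shaneson spheres are standard*, Algebr. Geom. Topol. 10 (2010)
  1665–1681, proof of Thm 2.1 and Lemma 2.2. [GompfAGT2010]
-/

noncomputable section

open scoped Real ContDiff Topology Manifold
open Set Function Filter Complex Metric

namespace Literature.Topology.FourManifolds

/-! ### A bound for the derivative of the smooth transition -/

/-- A bound `C₀ ≥ 1` of `|smoothTransition'|` exists. [folklore] -/
theorem exists_bound_deriv_smoothTransition' :
    ∃ C : ℝ, 1 ≤ C ∧ ∀ x : ℝ, ‖deriv Real.smoothTransition x‖ ≤ C := by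
  have hc : Continuous (deriv Real.smoothTransition) :=
    (Real.smoothTransition.contDiff (n := 1)).continuous_deriv le_rfl
  obtain ⟨C, hC⟩ := (isCompact_Icc (a := (0 : ℝ)) (b := 1)).exists_bound_of_continuousOn hc.continuousOn
  refine ⟨max C 1, le_max_right _ _, fun x ↦ ?_⟩
  by_cases hx : x ∈ Icc (0 : ℝ) 1
  · exact (hC x hx).trans (le_max_left _ _)
  · have h0 : deriv Real.smoothTransition x = 0 := by
      rcases not_and_or.1 hx with h | h
      · have : Real.smoothTransition =ᶠ[𝓝 x] fun _ ↦ (0 : ℝ) := by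
          filter_upwards [Iio_mem_nhds (lt_of_not_ge h)] with y hy
          exact Real.smoothTransition.zero_of_nonpos hy.le
        rw [this.deriv_eq]; simp
      · have : Real.smoothTransition =ᶠ[𝓝 x] fun _ ↦ (1 : ℝ) := by
          filter_upwards [Ioi_mem_nhds (lt_of_not_ge h)] with y hy
          exact Real.smoothTransition.one_of_one_le hy.le
        rw [this.deriv_eq]; simp
    rw [h0, norm_zero]
    exact zero_le_one.trans (le_max_right _ _)

namespace FP

/-- **The bound `C₀ ≥ 1` of `|smoothTransition'|`** (a choice). [folklore] -/
def C0 : ℝ := (exists_bound_deriv_smoothTransition').choose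

/-- `1 ≤ C0`. [folklore] -/
theorem one_le_C0 : 1 ≤ C0 := (exists_bound_deriv_smoothTransition').choose_spec.1

/-- `0 < C0`. [folklore] -/
theorem C0_pos : 0 < C0 := one_pos.trans_le one_le_C0

/-- `‖deriv Real.smoothTransition x‖ ≤ C0`. [folklore] -/
theorem norm_deriv_le_C0 (x : ℝ) : ‖deriv Real.smoothTransition x‖ ≤ C0 :=
  (exists_bound_deriv_smoothTransition').choose_spec.2 x

/-! ### The scalar parameters -/

variable (ε : ℝ)

/-- The puncture latitude `n_j = -9ε/10`. [folklore] -/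
def nj : ℝ := -(9 * ε / 10)

/-- `nj ε < 0`. [folklore] -/
theorem nj_neg (hε : 0 < ε) : nj ε < 0 := by unfold nj; linarith

/-- `nj ε ^ 2 < ε ^ 2`. [folklore] -/
theorem nj_sq_lt (hε : 0 < ε) : nj ε ^ 2 < ε ^ 2 := by unfold nj; nlinarith

/-- **The chart radius of the puncture** `t_j = 9/(10 √(19/100))` (independent of `ε`). [folklore] -/
theorem capTj_eq (hε : 0 < ε) : capTj ε (nj ε) = 9 / 10 / Real.sqrt (19 / 100) := by
  rw [capTj, capRad, nj, neg_neg, show ε ^ 2 - (-(9 * ε / 10)) ^ 2 = (19 / 100) * ε ^ 2 by ring,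
    Real.sqrt_mul (by norm_num), Real.sqrt_sq hε.le]
  have hs : 0 < Real.sqrt (19 / 100) := Real.sqrt_pos.2 (by norm_num)
  field_simp

/-- `2 < t_j < 21/10`. [folklore] -/
theorem capTj_bounds (hε : 0 < ε) : 2 < capTj ε (nj ε) ∧ capTj ε (nj ε) < 21 / 10 := by
  rw [capTj_eq ε hε]
  have hs : Real.sqrt (19 / 100) < 9 / 20 := by
    rw [Real.sqrt_lt' (by norm_num)]; norm_num
  have hs' : 3 / 7 < Real.sqrt (19 / 100) := by
    rw [Real.lt_sqrt (by norm_num)]; norm_num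
  have hpos : 0 < Real.sqrt (19 / 100) := Real.sqrt_pos.2 (by norm_num)
  constructor
  · rw [lt_div_iff₀ hpos]; linarith
  · rw [div_lt_iff₀ hpos]; linarith

/-- The collar annulus radius `ρ_A = 1/20` and the path radius `R₀ = 1/5`. [folklore] -/
def ρA : ℝ := 1 / 20
/-- The constant `R0 = 1 / 5` of the fishtail data. [folklore] -/
def R0 : ℝ := 1 / 5

/-- The offset scale over `D⁰`: `λ = ε / (10 (C₀ + 1))`. [folklore] -/
def lam : ℝ := ε / (10 * (C0 + 1))

/-- `0 < lam ε`. [folklore] -/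
theorem lam_pos (hε : 0 < ε) : 0 < lam ε := by unfold lam; have := C0_pos; positivity

/-- `lam ε ≤ ε / 10`. [folklore] -/
theorem lam_le (hε : 0 < ε) : lam ε ≤ ε / 10 := by
  unfold lam
  have := C0_pos
  rw [div_le_div_iff₀ (by positivity) (by norm_num)]
  nlinarith

/-- The scale profile (cone `κ(n) = n` for `n ≤ 0.47ε`, constant `λ` for `n ≥ 0.52ε`). [folklore] -/
def kap (n : ℝ) : ℝ := blendFun (stdBlend (47 * ε / 100) (52 * ε / 100)) (fun n ↦ n) (fun _ ↦ lam ε) n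

/-- The north switch profile (`0` for `n ≤ 0.565ε`, `1` for `n ≥ 0.605ε`). [folklore] -/
def muN (n : ℝ) : ℝ := stdBlend (113 * ε / 200) (121 * ε / 200) n

/-- The south switch profile (`0` for `n ≤ 0.70ε`, `1` for `n ≥ 0.86ε`). [folklore] -/
def muS (n : ℝ) : ℝ := stdBlend (7 * ε / 10) (43 * ε / 50) n

/-- The south glue latitudes and the angular slab. [folklore] -/
def nA : ℝ := 33 * ε / 50
/-- The constant `nB = 9 * ε / 10` of the fishtail data. [folklore] -/
def nB : ℝ := 9 * ε / 10
/-- The constant `etaA = ε / 25` of the fishtail data. [folklore] -/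
def etaA : ℝ := ε / 25

/-- The translation radii `R₁ = 2/5`, `R₂ = 17 C₀ + 5` and the glue slab `η = ε/(10 R₂²)`. [folklore] -/
def Rone : ℝ := 2 / 5
/-- The constant `Rtwo = 17 * C0 + 5` of the fishtail data. [folklore] -/
def Rtwo : ℝ := 17 * C0 + 5

/-- `22 ≤ Rtwo`. [folklore] -/
theorem Rtwo_ge : 22 ≤ Rtwo := by unfold Rtwo; linarith [one_le_C0]

/-- The constant `eta = ε / (10 * Rtwo ^ 2)` of the fishtail data. [folklore] -/
def eta : ℝ := ε / (10 * Rtwo ^ 2)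

/-- `0 < eta ε`. [folklore] -/
theorem eta_pos (hε : 0 < ε) : 0 < eta ε := by unfold eta; have := Rtwo_ge; positivity

/-- `eta ε ≤ ε / 4840`. [folklore] -/
theorem eta_le (hε : 0 < ε) : eta ε ≤ ε / 4840 := by
  unfold eta
  have h := Rtwo_ge
  have h2 : (4840 : ℝ) ≤ 10 * Rtwo ^ 2 := by nlinarith
  exact div_le_div_of_nonneg_left hε.le (by norm_num) h2

/-- The latitude profile data: `ρ_a = 1`, `ρ_b = 6/5`, `ρ₁ = 1`, `n₁ = 23ε/25`, slope `k`. [folklore] -/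
def kLat : ℝ := (2 * π - 127 * ε / 100) / 6

/-- `9 / 10 < kLat ε ∧ kLat ε < 21 / 20`. [folklore] -/
theorem kLat_bounds (hε : 0 < ε) (hε2 : ε ≤ 1 / 2) : 9 / 10 < kLat ε ∧ kLat ε < 21 / 20 := by
  unfold kLat; constructor <;> nlinarith [Real.pi_gt_d2, Real.pi_lt_d2]

/-- The master radius `r₀` of the angle `α = angleUp r₀` and the latitude blend `[a₂, b₂]`. [folklore] -/
def a2 : ℝ := 7
/-- The constant `b2 = 7 + ε / 100` of the fishtail data. [folklore] -/
def b2 : ℝ := 7 + ε / 100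
/-- The constant `rzero = b2 ε + 5` of the fishtail data. [folklore] -/
def rzero : ℝ := b2 ε + 5
/-- The constant `rone = rzero ε + 18` of the fishtail data. [folklore] -/
def rone : ℝ := rzero ε + 18

/-- The seven glue radii along `r = ‖ζ‖`. [folklore] -/
def s1 : ℝ := 3 / 4
/-- The constant `s2 = 1 + (2 * π - ε * (1 + Rtwo / Real.sqrt (1 + Rtwo ^ 2)) / 2 - 23 * ε / 25) / kLat ε` of the fishtail data. [folklore] -/
def s2 : ℝ := 1 + (2 * π - ε * (1 + Rtwo / Real.sqrt (1 + Rtwo ^ 2)) / 2 - 23 * ε / 25) / kLat ε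
/-- The constant `s3 = rzero ε - 1 / Real.sqrt 3 - 1 / 10` of the fishtail data. [folklore] -/
def s3 : ℝ := rzero ε - 1 / Real.sqrt 3 - 1 / 10
/-- The constant `s4 = rzero ε + Real.sqrt 3 - 1 / 10` of the fishtail data. [folklore] -/
def s4 : ℝ := rzero ε + Real.sqrt 3 - 1 / 10
/-- The constant `s5 = rzero ε + 6` of the fishtail data. [folklore] -/
def s5 : ℝ := rzero ε + 6
/-- The constant `a6 = rzero ε + 9` of the fishtail data. [folklore] -/
def a6 : ℝ := rzero ε + 9
/-- The constant `b6 = rzero ε + 13` of the fishtail data. [folklore] -/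
def b6 : ℝ := rzero ε + 13
/-- The constant `s6 = rone ε - Real.sqrt 3 - 1 / 2` of the fishtail data. [folklore] -/
def s6 : ℝ := rone ε - Real.sqrt 3 - 1 / 2
/-- The constant `s7 = rone ε + 1 / Real.sqrt 3 + 3 / 100` of the fishtail data. [folklore] -/
def s7 : ℝ := rone ε + 1 / Real.sqrt 3 + 3 / 100

/-- The path angle at the leg junction `β₇ = angleDown r₁ s₇ ∈ (-π/4, 0)`. [folklore] -/
def beta7 : ℝ := angleDown (rone ε) (s7 ε)

/-- `-π/4 < β₇ < 0` (indeed `β₇ ∈ (-0.04, -0.03)`; we only need signs and `tan β₇ ∈ (-1, 0)`). [folklore] -/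
theorem beta7_bounds : -(π / 4) < beta7 ε ∧ beta7 ε < 0 := by
  unfold beta7 angleDown
  have h3 : 0 < Real.sqrt 3 := Real.sqrt_pos.2 (by norm_num)
  have hx : s7 ε - rone ε = 1 / Real.sqrt 3 + 3 / 100 := by unfold s7; ring
  rw [hx]
  have hlo : π / 6 < Real.arctan (1 / Real.sqrt 3 + 3 / 100) := by
    rw [← Real.arctan_inv_sqrt_three, show (Real.sqrt 3)⁻¹ = 1 / Real.sqrt 3 by rw [one_div]]
    exact Real.arctan_strictMono (by linarith)
  have hhi : Real.arctan (1 / Real.sqrt 3 + 3 / 100) < π / 3 := by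
    rw [← Real.arctan_sqrt_three]
    refine Real.arctan_strictMono ?_
    -- `1/√3 + 0.03 < √3` since `√3 > 1.7`
    have h17 : (17 : ℝ) / 10 < Real.sqrt 3 := by rw [Real.lt_sqrt (by norm_num)]; norm_num
    have : 1 / Real.sqrt 3 < 10 / 17 := by rw [div_lt_div_iff₀ h3 (by norm_num)]; linarith
    linarith
  constructor <;> nlinarith [Real.pi_pos]

/-- `-1 < Real.tan (beta7 ε) ∧ Real.tan (beta7 ε) < 0`. [folklore] -/
theorem tan_beta7_bounds : -1 < Real.tan (beta7 ε) ∧ Real.tan (beta7 ε) < 0 := by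
  obtain ⟨h1, h2⟩ := beta7_bounds ε
  constructor
  · have := Real.tan_lt_tan_of_lt_of_lt_pi_div_two (by linarith [Real.pi_pos]) (by linarith [Real.pi_pos]) h1
    rwa [Real.tan_neg, Real.tan_pi_div_four] at this
  · have := Real.tan_lt_tan_of_lt_of_lt_pi_div_two (by linarith [Real.pi_pos]) (by linarith [Real.pi_pos]) h2
    rwa [Real.tan_zero] at this

/-! ### Radii chosen from existence theorems -/

/-- The Jacobian radius of the planar shell of radius `ρ`. [folklore] -/
def jacRad (ρ : ℝ) (hρ : 0 < ρ) : ℝ := (exists_jac_pathShell (ρ := ρ) hρ).choose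

/-- `0 < jacRad ρ hρ`. [folklore] -/
theorem jacRad_pos (ρ : ℝ) (hρ : 0 < ρ) : 0 < jacRad ρ hρ := (exists_jac_pathShell (ρ := ρ) hρ).choose_spec.1

/-- The Jacobian of the planar path shell does not vanish on the window of radius `jacRad`. [folklore] -/
theorem jacRad_spec (ρ : ℝ) (hρ : 0 < ρ) : ∀ q : ℝ × ℝ, -(π / 4) ≤ q.1 → q.1 ≤ π - Real.arctan (1 / 3) → |q.2| < jacRad ρ hρ →
    ∃ u v : ℝ × ℝ, HasDerivAt (fun x ↦ pathShell ρ (x, q.2)) u q.1 ∧ HasDerivAt (fun a ↦ pathShell ρ (q.1, a)) v q.2 ∧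
      u.1 * v.2 - u.2 * v.1 ≠ 0 := (exists_jac_pathShell (ρ := ρ) hρ).choose_spec.2

/-- The injectivity radius of the planar shell of radius `ρ`. [folklore] -/
def injRad (ρ : ℝ) (hρ : 0 < ρ) : ℝ := (exists_injOn_pathShell (ρ := ρ) hρ).choose

/-- `0 < injRad ρ hρ`. [folklore] -/
theorem injRad_pos (ρ : ℝ) (hρ : 0 < ρ) : 0 < injRad ρ hρ := (exists_injOn_pathShell (ρ := ρ) hρ).choose_spec.1

/-- `InjOn (pathShell ρ) (Icc (-(π / 4)) (π - Real.arctan (1 / 3)) ×ˢ Ioo (-injRad ρ hρ) (injRad ρ hρ))`. [folklore] -/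
theorem injRad_spec (ρ : ℝ) (hρ : 0 < ρ) :
    InjOn (pathShell ρ) (Icc (-(π / 4)) (π - Real.arctan (1 / 3)) ×ˢ Ioo (-injRad ρ hρ) (injRad ρ hρ)) :=
  (exists_injOn_pathShell (ρ := ρ) hρ).choose_spec.2

/-- `0 < ρA`. [folklore] -/
theorem ρA_pos : 0 < ρA := by unfold ρA; norm_num
/-- `0 < R0`. [folklore] -/
theorem R0_pos : 0 < R0 := by unfold R0; norm_num

/-- **A smallness radius of the cap-chart switch**: for `‖v‖ < r` and every `m ∈ [0, 1]` the
blended chart value `capSwitchMap ε n_j m v` has first component below `-n_j/2` and second below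
`1/4` in absolute value (both blended maps vanish at `0` and are continuous there). [folklore] -/
theorem exists_vertRad {ε nj : ℝ} (hε : 0 < ε) (hnj : nj ^ 2 < ε ^ 2) (hnj0 : nj < 0) :
    ∃ r > 0, ∀ m ∈ Icc (0 : ℝ) 1, ∀ v : ℂ, ‖v‖ < r →
      |(capSwitchMap ε nj m v).1| < -nj / 2 ∧ |(capSwitchMap ε nj m v).2| < 1 / 8 := by
  set c : ℝ := min (-nj / 2) (1 / 8) with hc
  have hc0 : 0 < c := lt_min (by linarith) (by norm_num)
  have h1 : ∀ᶠ v in 𝓝 (0 : ℂ), ‖capJL ε nj v‖ < c := by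
    have h : ContinuousAt (fun v ↦ capJL ε nj v) 0 := (capJL ε nj).continuous.continuousAt
    have h0 : ‖capJL ε nj 0‖ < c := by rw [map_zero, norm_zero]; exact hc0
    exact h.norm.eventually (gt_mem_nhds h0)
  have h2 : ∀ᶠ v in 𝓝 (0 : ℂ), ‖capPhi ε nj v‖ < c := by
    have h : ContinuousAt (capPhi ε nj) 0 := (contDiffAt_capPhi (n := 0) hnj hnj0).continuousAt
    have h0 : ‖capPhi ε nj 0‖ < c := by rw [capPhi_zero hε hnj hnj0, norm_zero]; exact hc0
    exact h.norm.eventually (gt_mem_nhds h0)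
  obtain ⟨r, hr, h⟩ := Metric.eventually_nhds_iff.1 (h1.and h2)
  refine ⟨r, hr, fun m hm v hv ↦ ?_⟩
  obtain ⟨hJ, hP⟩ := h (by simpa using hv)
  have hJ1 := (norm_fst_le (capJL ε nj v)).trans_lt hJ
  have hJ2 := (norm_snd_le (capJL ε nj v)).trans_lt hJ
  have hP1 := (norm_fst_le (capPhi ε nj v)).trans_lt hP
  have hP2 := (norm_snd_le (capPhi ε nj v)).trans_lt hP
  rw [Real.norm_eq_abs] at hJ1 hJ2 hP1 hP2
  have hc1 : c ≤ -nj / 2 := min_le_left _ _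
  have hc2 : c ≤ 1 / 8 := min_le_right _ _
  simp only [capSwitchMap, Prod.smul_fst, Prod.smul_snd, Prod.fst_add, Prod.snd_add, smul_eq_mul]
  obtain ⟨hm0, hm1⟩ := hm
  have key : ∀ a b : ℝ, |a| < c → |b| < c → |(1 - m) * a + m * b| < c := by
    intro a b ha hb
    have h3 : |(1 - m) * a + m * b| ≤ (1 - m) * |a| + m * |b| := by
      calc |(1 - m) * a + m * b| ≤ |(1 - m) * a| + |m * b| := abs_add_le _ _
        _ = (1 - m) * |a| + m * |b| := by rw [abs_mul, abs_mul, abs_of_nonneg (by linarith), abs_of_nonneg hm0]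
    rcases le_total m (1 / 2) with hm | hm
    · have := mul_lt_mul_of_pos_left ha (by linarith : (0:ℝ) < 1 - m)
      have := mul_le_mul_of_nonneg_left hb.le hm0
      linarith
    · have := mul_le_mul_of_nonneg_left ha.le (by linarith : (0:ℝ) ≤ 1 - m)
      have := mul_lt_mul_of_pos_left hb (by linarith : (0:ℝ) < m)
      linarith
  exact ⟨(key _ _ hJ1 hP1).trans_le hc1, (key _ _ hJ2 hP2).trans_le hc2⟩

/-- The smallness radius of the cap-chart switch (a choice). [folklore] -/
def vertRad {ε nj : ℝ} (hε : 0 < ε) (hnj : nj ^ 2 < ε ^ 2) (hnj0 : nj < 0) : ℝ := (exists_vertRad hε hnj hnj0).choose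

/-- `0 < vertRad hε hnj hnj0`. [folklore] -/
theorem vertRad_pos {ε nj : ℝ} (hε : 0 < ε) (hnj : nj ^ 2 < ε ^ 2) (hnj0 : nj < 0) : 0 < vertRad hε hnj hnj0 :=
  (exists_vertRad hε hnj hnj0).choose_spec.1

/-- The cap-chart switch is small on the ball of radius `vertRad`. [folklore] -/
theorem vertRad_spec {ε nj : ℝ} (hε : 0 < ε) (hnj : nj ^ 2 < ε ^ 2) (hnj0 : nj < 0) :
    ∀ m ∈ Icc (0 : ℝ) 1, ∀ v : ℂ, ‖v‖ < vertRad hε hnj hnj0 →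
      |(capSwitchMap ε nj m v).1| < -nj / 2 ∧ |(capSwitchMap ε nj m v).2| < 1 / 8 :=
  (exists_vertRad hε hnj hnj0).choose_spec.2

/-- The un-shear profile of the leg (`0` below `s₇ + 1/25`, `1` above `s₇ + 7/100`). [folklore] -/
def muL (r : ℝ) : ℝ := stdBlend (s7 ε + 1 / 25) (s7 ε + 7 / 100) r

/-- The leg-position blend `[a₈, b₈] = [s₇ + 2η, s₇ + 1/50]`. [folklore] -/
def a8 : ℝ := s7 ε + 2 * eta ε
/-- The constant `b8 = s7 ε + 1 / 50` of the fishtail data. [folklore] -/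
def b8 : ℝ := s7 ε + 1 / 50

/-- **The leg product** `L_c = c ρ_b = s₇ + 22/100 + tan β₇` (the leg length scale; only this
product enters the reference tube). [folklore] -/
def Lc : ℝ := s7 ε + 22 / 100 + Real.tan (beta7 ε)

/-! ### The vertical profile -/

/-- The top scalings `σ₁ = 1/(λ c_L)`, `σ₂ = 2π t_j/λ`. [folklore] -/
def sig1top : ℝ := 1 / (lam ε * capCL ε (nj ε))
/-- The constant `sig2top = 2 * π * capTj ε (nj ε) / lam ε` of the fishtail data. [folklore] -/
def sig2top : ℝ := 2 * π * capTj ε (nj ε) / lam ε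

/-- `1 ≤ sig1top ε`. [folklore] -/
theorem one_le_sig1top (hε : 0 < ε) (hε2 : ε ≤ 1 / 2) : 1 ≤ sig1top ε := by
  unfold sig1top
  have hl := lam_pos ε hε; have hl' := lam_le ε hε
  have hc := capCL_pos (nj := nj ε) hε
  -- `capCL ≤ ε` (denominator ≥ 1) and `λ ≤ ε/10 ≤ 1/20`
  have hcle : capCL ε (nj ε) ≤ ε := by
    unfold capCL
    have ht := (capTj_bounds ε hε).1
    have h1 : 1 ≤ (1 + capTj ε (nj ε) ^ 2) * Real.sqrt (1 + capTj ε (nj ε) ^ 2) := by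
      have hs : 1 ≤ Real.sqrt (1 + capTj ε (nj ε) ^ 2) := by
        rw [Real.le_sqrt (by norm_num) (by positivity)]; nlinarith
      nlinarith
    exact div_le_self hε.le h1
  rw [le_div_iff₀ (by positivity), one_mul]
  nlinarith

/-- `1 ≤ sig2top ε`. [folklore] -/
theorem one_le_sig2top (hε : 0 < ε) (hε2 : ε ≤ 1 / 2) : 1 ≤ sig2top ε := by
  unfold sig2top
  have hl := lam_pos ε hε; have hl' := lam_le ε hε
  have ht := (capTj_bounds ε hε).1
  rw [le_div_iff₀ hl, one_mul]
  nlinarith [Real.pi_gt_three]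

/-- **The vertical profile**: switch `m : 1 → 0` over `y ∈ [1, 6/5]`, frame rotation
`0 → π/2` and scalings `1 → σ_top` over `y ∈ [13/10, 3/2]`. [folklore] -/
def vert (hε : 0 < ε) (hε2 : ε ≤ 1 / 2) : VertProfile where
  m y := 1 - stdBlend 1 (6 / 5) y
  θ y := π / 2 * stdBlend (13 / 10) (3 / 2) y
  σ₁ y := 1 + (sig1top ε - 1) * stdBlend (13 / 10) (3 / 2) y
  σ₂ y := 1 + (sig2top ε - 1) * stdBlend (13 / 10) (3 / 2) y
  S := max (sig1top ε) (sig2top ε)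
  contDiff_m := contDiff_const.sub (contDiff_stdBlend _ _)
  contDiff_θ := contDiff_const.mul (contDiff_stdBlend _ _)
  contDiff_σ₁ := contDiff_const.add (contDiff_const.mul (contDiff_stdBlend _ _))
  contDiff_σ₂ := contDiff_const.add (contDiff_const.mul (contDiff_stdBlend _ _))
  m_mem y := by
    have h := stdBlend_mem 1 (6 / 5) y
    exact ⟨by linarith [h.2], by linarith [h.1]⟩
  σ₁_pos y := by
    have h := stdBlend_mem (13 / 10) (3 / 2) y
    have := one_le_sig1top ε hε hε2
    nlinarith
  σ₂_pos y := by
    have h := stdBlend_mem (13 / 10) (3 / 2) y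
    have := one_le_sig2top ε hε hε2
    nlinarith
  σ₁_le y := by
    have h := stdBlend_mem (13 / 10) (3 / 2) y
    have h1 := one_le_sig1top ε hε hε2
    have : 1 + (sig1top ε - 1) * stdBlend (13 / 10) (3 / 2) y ≤ sig1top ε := by nlinarith
    exact this.trans (le_max_left _ _)
  σ₂_le y := by
    have h := stdBlend_mem (13 / 10) (3 / 2) y
    have h1 := one_le_sig2top ε hε hε2
    have : 1 + (sig2top ε - 1) * stdBlend (13 / 10) (3 / 2) y ≤ sig2top ε := by nlinarith
    exact this.trans (le_max_right _ _)
  one_le_S := (one_le_sig1top ε hε hε2).trans (le_max_left _ _)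

/-! ### The tube data -/

/-- `0 ≤ Rone`. [folklore] -/
theorem Rone_nonneg : 0 ≤ Rone := by unfold Rone; norm_num
/-- `Rone < Rtwo`. [folklore] -/
theorem Rone_lt_Rtwo : Rone < Rtwo := by unfold Rone; linarith [Rtwo_ge]

/-- The room inequality of the translation disc: `4 C₀ R₂ t_j ≤ R₂² - R₁²`. [folklore] -/
theorem hroom (hε : 0 < ε) : 4 * C0 * Rtwo * ‖capD0 ε (nj ε)‖ ≤ Rtwo ^ 2 - Rone ^ 2 := by
  rw [norm_capD0 (nj_sq_lt ε hε) (nj_neg ε hε)]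
  have ht := (capTj_bounds ε hε).2
  have hC := one_le_C0
  unfold Rtwo Rone
  nlinarith [mul_pos (by linarith : (0:ℝ) < C0) (by linarith : (0:ℝ) < 17 * C0 + 5)]

end FP

open FP in
/-- **The tube data about Gompf's disc with free handle scale `c`, leg radius `ρ_b` and un-shear
profile `μ`** (all other parameters concrete). [folklore] -/
def fishTgen (ε : ℝ) (hε : 0 < ε) (hε2 : ε ≤ 1 / 2) (c ρb : ℝ) (μ : ℝ → ℝ) : TubeDData where
  ε := ε
  hε := hε
  hε2 := hε2
  nj := nj ε
  δ := 1 / 200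
  rσ₁ := 1 / 5
  rσ₂ := 1 / 4
  rσ₃ := 3 / 10
  lam := lam ε
  cN := 1
  cS := 1
  kapN := kap ε
  kapS := kap ε
  μN := muN ε
  μS := muS ε
  RM := capTj ε (nj ε) + 3 / 10
  nA := nA ε
  nB := nB ε
  R₁ := Rone
  R₂ := Rtwo
  C := C0
  hC := norm_deriv_le_C0
  hR₁ := Rone_nonneg
  hR₁₂ := Rone_lt_Rtwo
  hroom := hroom ε hε
  n₁ := 23 * ε / 25
  k := kLat ε
  ρ₁ := 1
  ρa := 1
  ρb := 6 / 5
  a₂ := a2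
  b₂ := b2 ε
  r₀ := rzero ε
  r₁ := rone ε
  ρA := ρA
  R₀ := R0
  yh := cY
  cL := c
  ρbL := ρb
  μL := μ
  V := vert ε hε hε2
  a₆ := a6 ε
  b₆ := b6 ε
  a₈ := a8 ε
  b₈ := b8 ε
  s₁ := s1
  s₂ := s2 ε
  s₃ := s3 ε
  s₄ := s4 ε
  s₅ := s5 ε
  s₆ := s6 ε
  s₇ := s7 ε

open FP in
/-- **The reference tube data**: handle scale `1`, leg radius `L_c`, no un-shearing (`μ = 0`). It does
not depend on the leg radius `ρ_b`; its tube is the reference tube whose injectivity radius bounds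
`ρ_b`. [folklore] -/
def fishTref (ε : ℝ) (hε : 0 < ε) (hε2 : ε ≤ 1 / 2) : TubeDData := fishTgen ε hε hε2 1 (Lc ε) fun _ ↦ 0

namespace FP

section Tub

variable (ε : ℝ) (hε : 0 < ε) (hε2 : ε ≤ 1 / 2)

/-- The radius of the disc on which the reference tube must be injective: `R = s₇ + 1`. [folklore] -/
def Rdisc : ℝ := s7 ε + 1

/-- **The good tube radii**: `δ ∈ [0, 1]` such that the reference tube is injective on
`{‖ζ‖ ≤ R} × {a² + b² < δ²}`. [folklore] -/
def tubGood : Set ℝ :=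
  {δ | 0 ≤ δ ∧ δ ≤ 1 ∧ InjOn (fishTref ε hε hε2).tubeD {q : ℂ × ℝ × ℝ | ‖q.1‖ ≤ Rdisc ε ∧ q.2.1 ^ 2 + q.2.2 ^ 2 < δ ^ 2}}

/-- **The injectivity radius of the reference tube** (a supremum; shown positive in
`FishtailTubeRef.lean`). [folklore] -/
def tubRad : ℝ := sSup (tubGood ε hε hε2)

/-- The injectivity radius made positive by fiat (`= tubRad` once that is known positive). [folklore] -/
def tubRad' : ℝ := if 0 < tubRad ε hε hε2 then tubRad ε hε hε2 else 1

/-- `0 < tubRad' ε hε hε2`. [folklore] -/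
theorem tubRad'_pos : 0 < tubRad' ε hε hε2 := by
  unfold tubRad'; split_ifs with h
  · exact h
  · exact one_pos

/-- `tubRad' ε hε hε2 = tubRad ε hε hε2`. [folklore] -/
theorem tubRad'_eq (h : 0 < tubRad ε hε hε2) : tubRad' ε hε hε2 = tubRad ε hε hε2 := by rw [tubRad', if_pos h]

end Tub

variable (ε : ℝ)

/-- **The tube radius at the leg** `ρ_b`: below `ε/13`, the switch and smallness radii of the cap
chart times `ε/13`, half the Jacobian and injectivity radii of the two shells, and half the
injectivity radius of the reference tube. [folklore] -/
def rhoB (hε : 0 < ε) (hε2 : ε ≤ 1 / 2) : ℝ :=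
  min (min (min (ε / 13) (min (ε * capSwitchRad hε (nj_sq_lt ε hε) (nj_neg ε hε) / 13)
      (ε * vertRad hε (nj_sq_lt ε hε) (nj_neg ε hε) / 13)))
    (min (min (jacRad R0 R0_pos / 2) (injRad R0 R0_pos / 2)) (min (jacRad ρA ρA_pos / 2) (injRad ρA ρA_pos / 2))))
    (tubRad' ε hε hε2 / 2)

variable {ε}

/-- `0 < rhoB ε hε hε2`. [folklore] -/
theorem rhoB_pos (hε : 0 < ε) (hε2 : ε ≤ 1 / 2) : 0 < rhoB ε hε hε2 := by
  unfold rhoB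
  have h1 := capSwitchRad_pos hε (nj_sq_lt ε hε) (nj_neg ε hε)
  have h1' := vertRad_pos hε (nj_sq_lt ε hε) (nj_neg ε hε)
  have h2 := jacRad_pos R0 R0_pos; have h3 := injRad_pos R0 R0_pos
  have h4 := jacRad_pos ρA ρA_pos; have h5 := injRad_pos ρA ρA_pos
  have h6 := tubRad'_pos ε hε hε2
  refine lt_min (lt_min (lt_min (by positivity) (lt_min (by positivity) (by positivity)))
    (lt_min (lt_min (by positivity) (by positivity)) (lt_min (by positivity) (by positivity)))) (by positivity)

/-- `rhoB ε hε hε2 ≤ ε / 13`. [folklore] -/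
theorem rhoB_le_eps' (hε : 0 < ε) (hε2 : ε ≤ 1 / 2) : rhoB ε hε hε2 ≤ ε / 13 :=
  (min_le_left _ _).trans ((min_le_left _ _).trans (min_le_left _ _))

/-- `rhoB ε hε hε2 ≤ ε / 8`. [folklore] -/
theorem rhoB_le_eps (hε : 0 < ε) (hε2 : ε ≤ 1 / 2) : rhoB ε hε hε2 ≤ ε / 8 := (rhoB_le_eps' hε hε2).trans (by linarith)

/-- `rhoB ε hε hε2 ≤ ε * capSwitchRad hε (nj_sq_lt ε hε) (nj_neg ε hε) / 13`. [folklore] -/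
theorem rhoB_le_switch (hε : 0 < ε) (hε2 : ε ≤ 1 / 2) : rhoB ε hε hε2 ≤ ε * capSwitchRad hε (nj_sq_lt ε hε) (nj_neg ε hε) / 13 :=
  (min_le_left _ _).trans ((min_le_left _ _).trans ((min_le_right _ _).trans (min_le_left _ _)))

/-- `rhoB ε hε hε2 ≤ ε * vertRad hε (nj_sq_lt ε hε) (nj_neg ε hε) / 13`. [folklore] -/
theorem rhoB_le_vert (hε : 0 < ε) (hε2 : ε ≤ 1 / 2) : rhoB ε hε hε2 ≤ ε * vertRad hε (nj_sq_lt ε hε) (nj_neg ε hε) / 13 :=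
  (min_le_left _ _).trans ((min_le_left _ _).trans ((min_le_right _ _).trans (min_le_right _ _)))

/-- `rhoB ε hε hε2 ≤ jacRad R0 R0_pos / 2`. [folklore] -/
theorem rhoB_le_jacR0 (hε : 0 < ε) (hε2 : ε ≤ 1 / 2) : rhoB ε hε hε2 ≤ jacRad R0 R0_pos / 2 :=
  (min_le_left _ _).trans ((min_le_right _ _).trans ((min_le_left _ _).trans (min_le_left _ _)))

/-- `rhoB ε hε hε2 ≤ injRad R0 R0_pos / 2`. [folklore] -/
theorem rhoB_le_injR0 (hε : 0 < ε) (hε2 : ε ≤ 1 / 2) : rhoB ε hε hε2 ≤ injRad R0 R0_pos / 2 :=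
  (min_le_left _ _).trans ((min_le_right _ _).trans ((min_le_left _ _).trans (min_le_right _ _)))

/-- `rhoB ε hε hε2 ≤ jacRad ρA ρA_pos / 2`. [folklore] -/
theorem rhoB_le_jacA (hε : 0 < ε) (hε2 : ε ≤ 1 / 2) : rhoB ε hε hε2 ≤ jacRad ρA ρA_pos / 2 :=
  (min_le_left _ _).trans ((min_le_right _ _).trans ((min_le_right _ _).trans (min_le_left _ _)))

/-- `rhoB ε hε hε2 ≤ injRad ρA ρA_pos / 2`. [folklore] -/
theorem rhoB_le_injA (hε : 0 < ε) (hε2 : ε ≤ 1 / 2) : rhoB ε hε hε2 ≤ injRad ρA ρA_pos / 2 :=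
  (min_le_left _ _).trans ((min_le_right _ _).trans ((min_le_right _ _).trans (min_le_right _ _)))

/-- `rhoB ε hε hε2 ≤ tubRad' ε hε hε2 / 2`. [folklore] -/
theorem rhoB_le_tub (hε : 0 < ε) (hε2 : ε ≤ 1 / 2) : rhoB ε hε hε2 ≤ tubRad' ε hε hε2 / 2 := min_le_right _ _

/-- `rhoB ε hε hε2 ≤ 1 / 16`. [folklore] -/
theorem rhoB_le (hε : 0 < ε) (hε2 : ε ≤ 1 / 2) : rhoB ε hε hε2 ≤ 1 / 16 := by linarith [rhoB_le_eps hε hε2]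

/-- `rhoB ε hε hε2 ≤ 1 / 26`. [folklore] -/
theorem rhoB_le' (hε : 0 < ε) (hε2 : ε ≤ 1 / 2) : rhoB ε hε hε2 ≤ 1 / 26 := by linarith [rhoB_le_eps' hε hε2]

variable (ε)

/-- **The handle scale `c = L_c / ρ_b`** (so that the leg position of the path at the junction is
`r_L(β₇) = s₇ - 3/100`). [folklore] -/
def cL (hε : 0 < ε) (hε2 : ε ≤ 1 / 2) : ℝ := Lc ε / rhoB ε hε hε2

end FP

open FP in
/-- **The concrete tube data about Gompf's disc.** [folklore] -/
def fishT (ε : ℝ) (hε : 0 < ε) (hε2 : ε ≤ 1 / 2) : TubeDData :=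
  fishTgen ε hε hε2 (cL ε hε hε2) (rhoB ε hε hε2) (muL ε)

namespace FP

variable (ε : ℝ) (hε : 0 < ε) (hε2 : ε ≤ 1 / 2)

/-- The depth scale `E₁ = min (1/100) (1/(100 (C₀ + 1)))`, the corner parameters
`δ_c = 3/(100 c)`, `p₁ = 1/(50 c)`. [folklore] -/
def E1 : ℝ := min (1 / 100) (1 / (100 * (C0 + 1)))
/-- The constant `delC = 3 / (100 * cL ε hε hε2)` of the fishtail data. [folklore] -/
def delC : ℝ := 3 / (100 * cL ε hε hε2)
/-- The constant `p1 = 1 / (50 * cL ε hε hε2)` of the fishtail data. [folklore] -/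
def p1 : ℝ := 1 / (50 * cL ε hε hε2)

/-- `0 < E1`. [folklore] -/
theorem E1_pos : 0 < E1 := by unfold E1; have := C0_pos; exact lt_min (by norm_num) (by positivity)
/-- `E1 ≤ 1 / 100`. [folklore] -/
theorem E1_le : E1 ≤ 1 / 100 := min_le_left _ _
/-- `E1 ≤ 1 / (100 * (C0 + 1))`. [folklore] -/
theorem E1_le' : E1 ≤ 1 / (100 * (C0 + 1)) := min_le_right _ _

include hε in
/-- `s₇ > 30`, so `c ρ_b = s₇ + 22/100 + tan β₇ > 29` and `c > 0`. [folklore] -/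
theorem s7_gt : 30 < s7 ε := by
  unfold s7 rone rzero b2
  have h3 : 0 < 1 / Real.sqrt 3 := by positivity
  linarith

include hε hε2 in
/-- `cL ε hε hε2 * rhoB ε hε hε2 = Lc ε`. [folklore] -/
theorem cL_mul_rhoB' : cL ε hε hε2 * rhoB ε hε hε2 = Lc ε := by
  unfold cL
  field_simp [(rhoB_pos hε hε2).ne']

include hε hε2 in
/-- `cL ε hε hε2 * rhoB ε hε hε2 = s7 ε + 22 / 100 + Real.tan (beta7 ε)`. [folklore] -/
theorem cL_mul_rhoB : cL ε hε hε2 * rhoB ε hε hε2 = s7 ε + 22 / 100 + Real.tan (beta7 ε) := cL_mul_rhoB' ε hε hε2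

include hε hε2 in
/-- `0 < cL ε hε hε2`. [folklore] -/
theorem cL_pos : 0 < cL ε hε hε2 := by
  have h := cL_mul_rhoB ε hε hε2
  have h7 := s7_gt ε hε
  have ht := (tan_beta7_bounds ε).1
  have hρ := rhoB_pos hε hε2
  by_contra hle
  have : cL ε hε hε2 * rhoB ε hε hε2 ≤ 0 := mul_nonpos_of_nonpos_of_nonneg (not_lt.1 hle) hρ.le
  linarith

include hε hε2 in
/-- `c ≥ 29 · 16 = 464` (since `ρ_b ≤ 1/16`). [folklore] -/
theorem cL_ge : 464 ≤ cL ε hε hε2 := by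
  have h := cL_mul_rhoB ε hε hε2
  have h7 := s7_gt ε hε
  have ht := (tan_beta7_bounds ε).1
  have hρ := rhoB_pos hε hε2
  have hρ' := rhoB_le hε hε2
  have h29 : 29 ≤ cL ε hε hε2 * rhoB ε hε hε2 := by linarith
  by_contra hlt
  have : cL ε hε hε2 * rhoB ε hε hε2 < 464 * (1 / 16) := by
    calc cL ε hε hε2 * rhoB ε hε hε2 < 464 * rhoB ε hε hε2 := mul_lt_mul_of_pos_right (not_le.1 hlt) hρ
      _ ≤ 464 * (1 / 16) := by nlinarith
  linarith

end FP

end Literature.Topology.FourManifolds
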